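import Summits.HodgeConjecture.CorCM.IrreducibleOddWeightsIsotypicSplittingFamilies
import Summits.HodgeConjecture.CorCM.IrreducibleOddWeightsIsotypicSplittingCMFields
import HarnessLib

/-!
# Isotypic cells, XII (CM fields): `dim Hg(A₀)+dim Hg(A₁)−dim Hg(A₀×A₁)` IS THE SUM OF THE CLASS DEFECTS OVER ALL
# ISOTYPIC CLASSES OF THE ODD WEIGHTS

COR-CM (cell `pub-hodgecm2`, binder seat `b16` gen 70, count-neutral claim ISOTYPIC SPLITTING OF THE DEFECT, file I12 —
CM fields; theorems only, no definition, no named fact, no `sorry`).  NEW as stated, hence under `Summits/`.  HONEST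
FRAMING: Galois theory of CM fields inside `ℂ` and linear algebra of odd weights (files I1–I11), with consequences for
`dim MT(A₀ × A₁)` of abelian varieties with complex multiplication (Kubota–Dodson rank = `dim MT`, Pohlmann); nothing is
claimed about the algebraicity of Hodge classes; `HC_CM` is neither used nor asserted.

SETTING.  CM fields `K_{i₀} ⊇ T₀`, `K_{i₁} ⊇ T₁`, the subfields `T_κ` containing the traces (TR); the SHADOW `w_κ` of
`Φ_κ` on `Hom(T_κ, ℂ)`.  The `Aut(ℂ)`-stable irreducible constituents `A⁰_j ≤ ℚ^{Hom(T₀,ℂ)}`, `A¹_j ≤ ℚ^{Hom(T₁,ℂ)}` of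
two finite families carry CLASS LABELS `c₀ j`, `c₁ j ∈ C` such that no non-zero constituent embeds equivariantly into a
constituent with a different label (e.g. labels = isomorphism classes of the odd irreducible `Aut(ℂ)`-modules met).

* **`cmTypeRank_add_cmTypeRank_eq_add_sum_of_classes`**: `w_κ = Σ_c p^κ_c` with class components `p^κ_c` ⟹
  **`cmTypeRank Φ₀ + cmTypeRank Φ₁ = cmFamilyRank Φ + 1 + Σ_c dim(S(p⁰_c) ∩ S(p¹_c))`** — the defect
  `dim Hg(A₀)+dim Hg(A₁)−dim Hg(A₀×A₁)` is the SUM over the classes of the class defects (file I7 is the case of two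
  labels); **`exists_cmTypeRank_add_cmTypeRank_eq_add_sum_of_classes`** produces the class components from
  `w_κ ∈ Σ_j A^κ_j` (always available for `Anti(T_κ)` decomposed into irreducibles, `…_of_antiWeights_le`).
* Reading the summands: a class met by one side only gives `0`; a class all of whose constituents on `T₀` have
  dimension `d` gives a multiple of `d` (I5/I7); an absolutely irreducible class gives `(rank b + rank b′ − rank(b⊔b′))·d`
  (I9/I10); one constituent per side gives `0` or `d` (gen 69 Q3/Q4).

## References

* [Gordon1999HodgeAVSurvey] B. B. Gordon, *A survey of the Hodge conjecture for abelian varieties*, §3 Theorem (Imai,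
  Murty) with proof, 7.5–7.7, 9.4.3.
* [Serre1977] J.-P. Serre, *Linear Representations of Finite Groups*, GTM 42, §2.6.
* [Shimura1998] G. Shimura, *Abelian Varieties with Complex Multiplication and Modular Functions*, §18.1.
* [Deligne1982HodgeCycles] P. Deligne, *Hodge cycles on abelian varieties*, LNM 900, I §3 Ex. 3.7.
-/

set_option autoImplicit false

noncomputable section

open scoped BigOperators Classical

open CategoryTheory CategoryTheory.Limits NumberField Module IntermediateField

namespace Summit.HodgeConjecture.CorCM

open Literature.NumberTheory.ComplexMultiplication
open Literature.AlgebraicGeometry.Motives (AbelianVariety CMType)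
open Literature.AlgebraicGeometry.Motives.AbelianVariety
open Literature.AlgebraicGeometry.HodgeTheory
open Literature.AlgebraicGeometry.ComplexMultiplication (IsCMTypeRealisation)
open Literature.AlgebraicGeometry.Pohlmann1968

variable {I : Type} [Fintype I] {K : I → Type} [∀ i, Field (K i)] [∀ i, NumberField (K i)] [∀ i, IsCMField (K i)]
  {T₀ : Type} [Field T₀] [NumberField T₀] {T₁ : Type} [Field T₁] [NumberField T₁]

/-- **THE DEFECT IS THE SUM OF THE CLASS DEFECTS (CM fields).**  `T₀ ⊆ K_{i₀}`, `T₁ ⊆ K_{i₁}` subfields containing the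
traces (TR); labelled `Aut(ℂ)`-stable irreducible constituents `A⁰_j ≤ ℚ^{Hom(T₀,ℂ)}`, `A¹_j ≤ ℚ^{Hom(T₁,ℂ)}`, no
non-zero constituent embedding equivariantly into one with a different label; the shadows written as sums of class
components, `w_κ = Σ_c p^κ_c`.  Then
**`cmTypeRank Φ₀ + cmTypeRank Φ₁ = cmFamilyRank Φ + 1 + Σ_c dim(S(p⁰_c) ∩ S(p¹_c))`**.
[cite: Gordon1999HodgeAVSurvey, §3 Theorem, 7.5–7.7 and 9.4.3] [cite: Serre1977, §2.6]
[cite: Deligne1982HodgeCycles, I §3 Ex. 3.7] -/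
theorem cmTypeRank_add_cmTypeRank_eq_add_sum_of_classes {i₀ i₁ : I} (h01 : i₀ ≠ i₁) (hI : ∀ l, l = i₀ ∨ l = i₁)
    (Φ : ∀ i, CMType (K i)) [Algebra T₀ (K i₀)] [Algebra T₁ (K i₁)]
    (htr₀ : ∀ (a : K i₀ →+* ℂ) (k : K i₀), a k ∈ normalClosure ℚ (K i₁) ℂ → k ∈ Set.range (algebraMap T₀ (K i₀)))
    (htr₁ : ∀ (b : K i₁ →+* ℂ) (k : K i₁), b k ∈ normalClosure ℚ (K i₀) ℂ → k ∈ Set.range (algebraMap T₁ (K i₁)))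
    {C : Type} [Fintype C] {J₀ J₁ : Type} [Fintype J₀] [Fintype J₁] (c₀ : J₀ → C) (c₁ : J₁ → C)
    {A₀ : J₀ → Submodule ℚ ((T₀ →+* ℂ) → ℚ)} {A₁ : J₁ → Submodule ℚ ((T₁ →+* ℂ) → ℚ)}
    (hA₀st : ∀ (j : J₀) (k : ℂ ≃+* ℂ) (a : (T₀ →+* ℂ) → ℚ), a ∈ A₀ j → (fun y => a (k • y)) ∈ A₀ j)
    (hA₀irr : ∀ (j : J₀) (W : Submodule ℚ ((T₀ →+* ℂ) → ℚ)), W ≤ A₀ j → W ≠ ⊥ →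
      (∀ (k : ℂ ≃+* ℂ) (f : (T₀ →+* ℂ) → ℚ), f ∈ W → (fun y => f (k • y)) ∈ W) → W = A₀ j)
    (hA₁st : ∀ (j : J₁) (k : ℂ ≃+* ℂ) (a : (T₁ →+* ℂ) → ℚ), a ∈ A₁ j → (fun y => a (k • y)) ∈ A₁ j)
    (hA₁irr : ∀ (j : J₁) (W : Submodule ℚ ((T₁ →+* ℂ) → ℚ)), W ≤ A₁ j → W ≠ ⊥ →
      (∀ (k : ℂ ≃+* ℂ) (f : (T₁ →+* ℂ) → ℚ), f ∈ W → (fun y => f (k • y)) ∈ W) → W = A₁ j)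
    (h₀₀ : ∀ (j k : J₀) (L : ((T₀ →+* ℂ) → ℚ) →ₗ[ℚ] ((T₀ →+* ℂ) → ℚ)), c₀ j ≠ c₀ k → A₀ j ≠ ⊥ →
      (∀ a ∈ A₀ j, L a ∈ A₀ k) → (∀ a ∈ A₀ j, L a = 0 → a = 0) →
      (∀ (g : ℂ ≃+* ℂ) (a : (T₀ →+* ℂ) → ℚ), a ∈ A₀ j → L (fun y => a (g • y)) = fun y => L a (g • y)) → False)
    (h₀₁ : ∀ (j : J₀) (k : J₁) (L : ((T₀ →+* ℂ) → ℚ) →ₗ[ℚ] ((T₁ →+* ℂ) → ℚ)), c₀ j ≠ c₁ k → A₀ j ≠ ⊥ →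
      (∀ a ∈ A₀ j, L a ∈ A₁ k) → (∀ a ∈ A₀ j, L a = 0 → a = 0) →
      (∀ (g : ℂ ≃+* ℂ) (a : (T₀ →+* ℂ) → ℚ), a ∈ A₀ j → L (fun y => a (g • y)) = fun y => L a (g • y)) → False)
    (h₁₀ : ∀ (j : J₁) (k : J₀) (L : ((T₁ →+* ℂ) → ℚ) →ₗ[ℚ] ((T₀ →+* ℂ) → ℚ)), c₁ j ≠ c₀ k → A₁ j ≠ ⊥ →
      (∀ a ∈ A₁ j, L a ∈ A₀ k) → (∀ a ∈ A₁ j, L a = 0 → a = 0) →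
      (∀ (g : ℂ ≃+* ℂ) (a : (T₁ →+* ℂ) → ℚ), a ∈ A₁ j → L (fun y => a (g • y)) = fun y => L a (g • y)) → False)
    (h₁₁ : ∀ (j k : J₁) (L : ((T₁ →+* ℂ) → ℚ) →ₗ[ℚ] ((T₁ →+* ℂ) → ℚ)), c₁ j ≠ c₁ k → A₁ j ≠ ⊥ →
      (∀ a ∈ A₁ j, L a ∈ A₁ k) → (∀ a ∈ A₁ j, L a = 0 → a = 0) →
      (∀ (g : ℂ ≃+* ℂ) (a : (T₁ →+* ℂ) → ℚ), a ∈ A₁ j → L (fun y => a (g • y)) = fun y => L a (g • y)) → False)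
    {p₀ : C → ((T₀ →+* ℂ) → ℚ)} {p₁ : C → ((T₁ →+* ℂ) → ℚ)}
    (hp₀ : ∀ c, p₀ c ∈ ⨆ j : {j // c₀ j = c}, A₀ j.1) (hp₁ : ∀ c, p₁ c ∈ ⨆ j : {j // c₁ j = c}, A₁ j.1)
    (hw₀ : (fun y : T₀ →+* ℂ => ∑ t ∈ Finset.univ.filter (fun t : K i₀ →+* ℂ => t.comp (algebraMap T₀ (K i₀)) = y),
        antiVec (Φ i₀).1 (1 : ℂ ≃+* ℂ) t) = ∑ c, p₀ c)
    (hw₁ : (fun y : T₁ →+* ℂ => ∑ t ∈ Finset.univ.filter (fun t : K i₁ →+* ℂ => t.comp (algebraMap T₁ (K i₁)) = y),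
        antiVec (Φ i₁).1 (1 : ℂ ≃+* ℂ) t) = ∑ c, p₁ c) :
    cmTypeRank (Φ i₀) + cmTypeRank (Φ i₁) = CMAlgebra.cmFamilyRank Φ + 1 +
      ∑ c, Module.finrank ℚ ↥(Submodule.span ℚ (Set.range fun y : T₀ →+* ℂ => fun g : ℂ ≃+* ℂ => p₀ c (g • y)) ⊓
        Submodule.span ℚ (Set.range fun y : T₁ →+* ℂ => fun g : ℂ ≃+* ℂ => p₁ c (g • y))) := by
  haveI : ∀ i, Nonempty (K i →+* ℂ) := fun i => inferInstance
  exact IrrOdd.typeRank_add_typeRank_eq_add_sum_of_classes (G := ℂ ≃+* ℂ) (E := fun i => K i →+* ℂ)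
    (Φ := fun i => (Φ i).1) (fun i => isCMTypeWith_conj (Φ i)) hI h01
    (fun t : K i₀ →+* ℂ => t.comp (algebraMap T₀ (K i₀))) (fun t : K i₁ →+* ℂ => t.comp (algebraMap T₁ (K i₁)))
    (fun _ _ => rfl) (fun _ _ => rfl) (exists_stab_smul_eq_of_comp_eq_of_trace_le i₁ htr₀)
    (exists_stab_smul_eq_of_comp_eq_of_trace_le i₀ htr₁) c₀ c₁ hA₀st hA₀irr hA₁st hA₁irr h₀₀ h₀₁ h₁₀ h₁₁ hp₀ hp₁
    hw₀ hw₁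

/-- **THE SAME, PRODUCING THE CLASS COMPONENTS (CM fields)**: if the shadows lie in the sums of the labelled
constituents, `w_κ ∈ Σ_j A^κ_j`, then class components exist with `w_κ = Σ_c p^κ_c` and
`cmTypeRank Φ₀ + cmTypeRank Φ₁ = cmFamilyRank Φ + 1 + Σ_c dim(S(p⁰_c) ∩ S(p¹_c))`.
[cite: Gordon1999HodgeAVSurvey, §3 Theorem, 7.5–7.7 and 9.4.3] [cite: Serre1977, §2.6] -/
theorem exists_cmTypeRank_add_cmTypeRank_eq_add_sum_of_classes {i₀ i₁ : I} (h01 : i₀ ≠ i₁)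
    (hI : ∀ l, l = i₀ ∨ l = i₁) (Φ : ∀ i, CMType (K i)) [Algebra T₀ (K i₀)] [Algebra T₁ (K i₁)]
    (htr₀ : ∀ (a : K i₀ →+* ℂ) (k : K i₀), a k ∈ normalClosure ℚ (K i₁) ℂ → k ∈ Set.range (algebraMap T₀ (K i₀)))
    (htr₁ : ∀ (b : K i₁ →+* ℂ) (k : K i₁), b k ∈ normalClosure ℚ (K i₀) ℂ → k ∈ Set.range (algebraMap T₁ (K i₁)))
    {C : Type} [Fintype C] {J₀ J₁ : Type} [Fintype J₀] [Fintype J₁] (c₀ : J₀ → C) (c₁ : J₁ → C)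
    {A₀ : J₀ → Submodule ℚ ((T₀ →+* ℂ) → ℚ)} {A₁ : J₁ → Submodule ℚ ((T₁ →+* ℂ) → ℚ)}
    (hA₀st : ∀ (j : J₀) (k : ℂ ≃+* ℂ) (a : (T₀ →+* ℂ) → ℚ), a ∈ A₀ j → (fun y => a (k • y)) ∈ A₀ j)
    (hA₀irr : ∀ (j : J₀) (W : Submodule ℚ ((T₀ →+* ℂ) → ℚ)), W ≤ A₀ j → W ≠ ⊥ →
      (∀ (k : ℂ ≃+* ℂ) (f : (T₀ →+* ℂ) → ℚ), f ∈ W → (fun y => f (k • y)) ∈ W) → W = A₀ j)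
    (hA₁st : ∀ (j : J₁) (k : ℂ ≃+* ℂ) (a : (T₁ →+* ℂ) → ℚ), a ∈ A₁ j → (fun y => a (k • y)) ∈ A₁ j)
    (hA₁irr : ∀ (j : J₁) (W : Submodule ℚ ((T₁ →+* ℂ) → ℚ)), W ≤ A₁ j → W ≠ ⊥ →
      (∀ (k : ℂ ≃+* ℂ) (f : (T₁ →+* ℂ) → ℚ), f ∈ W → (fun y => f (k • y)) ∈ W) → W = A₁ j)
    (h₀₀ : ∀ (j k : J₀) (L : ((T₀ →+* ℂ) → ℚ) →ₗ[ℚ] ((T₀ →+* ℂ) → ℚ)), c₀ j ≠ c₀ k → A₀ j ≠ ⊥ →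
      (∀ a ∈ A₀ j, L a ∈ A₀ k) → (∀ a ∈ A₀ j, L a = 0 → a = 0) →
      (∀ (g : ℂ ≃+* ℂ) (a : (T₀ →+* ℂ) → ℚ), a ∈ A₀ j → L (fun y => a (g • y)) = fun y => L a (g • y)) → False)
    (h₀₁ : ∀ (j : J₀) (k : J₁) (L : ((T₀ →+* ℂ) → ℚ) →ₗ[ℚ] ((T₁ →+* ℂ) → ℚ)), c₀ j ≠ c₁ k → A₀ j ≠ ⊥ →
      (∀ a ∈ A₀ j, L a ∈ A₁ k) → (∀ a ∈ A₀ j, L a = 0 → a = 0) →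
      (∀ (g : ℂ ≃+* ℂ) (a : (T₀ →+* ℂ) → ℚ), a ∈ A₀ j → L (fun y => a (g • y)) = fun y => L a (g • y)) → False)
    (h₁₀ : ∀ (j : J₁) (k : J₀) (L : ((T₁ →+* ℂ) → ℚ) →ₗ[ℚ] ((T₀ →+* ℂ) → ℚ)), c₁ j ≠ c₀ k → A₁ j ≠ ⊥ →
      (∀ a ∈ A₁ j, L a ∈ A₀ k) → (∀ a ∈ A₁ j, L a = 0 → a = 0) →
      (∀ (g : ℂ ≃+* ℂ) (a : (T₁ →+* ℂ) → ℚ), a ∈ A₁ j → L (fun y => a (g • y)) = fun y => L a (g • y)) → False)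
    (h₁₁ : ∀ (j k : J₁) (L : ((T₁ →+* ℂ) → ℚ) →ₗ[ℚ] ((T₁ →+* ℂ) → ℚ)), c₁ j ≠ c₁ k → A₁ j ≠ ⊥ →
      (∀ a ∈ A₁ j, L a ∈ A₁ k) → (∀ a ∈ A₁ j, L a = 0 → a = 0) →
      (∀ (g : ℂ ≃+* ℂ) (a : (T₁ →+* ℂ) → ℚ), a ∈ A₁ j → L (fun y => a (g • y)) = fun y => L a (g • y)) → False)
    (hw₀ : (fun y : T₀ →+* ℂ => ∑ t ∈ Finset.univ.filter (fun t : K i₀ →+* ℂ => t.comp (algebraMap T₀ (K i₀)) = y),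
        antiVec (Φ i₀).1 (1 : ℂ ≃+* ℂ) t) ∈ ⨆ j, A₀ j)
    (hw₁ : (fun y : T₁ →+* ℂ => ∑ t ∈ Finset.univ.filter (fun t : K i₁ →+* ℂ => t.comp (algebraMap T₁ (K i₁)) = y),
        antiVec (Φ i₁).1 (1 : ℂ ≃+* ℂ) t) ∈ ⨆ j, A₁ j) :
    ∃ (p₀ : C → ((T₀ →+* ℂ) → ℚ)) (p₁ : C → ((T₁ →+* ℂ) → ℚ)),
      (∀ c, p₀ c ∈ ⨆ j : {j // c₀ j = c}, A₀ j.1) ∧ (∀ c, p₁ c ∈ ⨆ j : {j // c₁ j = c}, A₁ j.1) ∧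
      (fun y : T₀ →+* ℂ => ∑ t ∈ Finset.univ.filter (fun t : K i₀ →+* ℂ => t.comp (algebraMap T₀ (K i₀)) = y),
        antiVec (Φ i₀).1 (1 : ℂ ≃+* ℂ) t) = ∑ c, p₀ c ∧
      (fun y : T₁ →+* ℂ => ∑ t ∈ Finset.univ.filter (fun t : K i₁ →+* ℂ => t.comp (algebraMap T₁ (K i₁)) = y),
        antiVec (Φ i₁).1 (1 : ℂ ≃+* ℂ) t) = ∑ c, p₁ c ∧
      cmTypeRank (Φ i₀) + cmTypeRank (Φ i₁) = CMAlgebra.cmFamilyRank Φ + 1 +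
        ∑ c, Module.finrank ℚ ↥(Submodule.span ℚ (Set.range fun y : T₀ →+* ℂ => fun g : ℂ ≃+* ℂ => p₀ c (g • y)) ⊓
          Submodule.span ℚ (Set.range fun y : T₁ →+* ℂ => fun g : ℂ ≃+* ℂ => p₁ c (g • y))) := by
  haveI : ∀ i, Nonempty (K i →+* ℂ) := fun i => inferInstance
  exact IrrOdd.exists_typeRank_add_typeRank_eq_add_sum_of_classes (G := ℂ ≃+* ℂ) (E := fun i => K i →+* ℂ)
    (Φ := fun i => (Φ i).1) (fun i => isCMTypeWith_conj (Φ i)) hI h01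
    (fun t : K i₀ →+* ℂ => t.comp (algebraMap T₀ (K i₀))) (fun t : K i₁ →+* ℂ => t.comp (algebraMap T₁ (K i₁)))
    (fun _ _ => rfl) (fun _ _ => rfl) (exists_stab_smul_eq_of_comp_eq_of_trace_le i₁ htr₀)
    (exists_stab_smul_eq_of_comp_eq_of_trace_le i₀ htr₁) c₀ c₁ hA₀st hA₀irr hA₁st hA₁irr h₀₀ h₀₁ h₁₀ h₁₁ hw₀ hw₁

/-- **WHEN `Anti(T₀)` AND `Anti(T₁)` ARE DECOMPOSED INTO LABELLED IRREDUCIBLES** (the odd weights are semisimple, so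
such decompositions always exist): for EVERY pair of CM types the defect `dim Hg(A₀)+dim Hg(A₁)−dim Hg(A₀×A₁)` is the
sum over the labels of the class defects of the class components of the two shadows.
[cite: Gordon1999HodgeAVSurvey, §3 Theorem, 7.5–7.7 and 9.4.3] [cite: Serre1977, §2.6] [cite: Shimura1998, §18.1] -/
theorem exists_cmTypeRank_add_cmTypeRank_eq_add_sum_of_classes_of_antiWeights_le {i₀ i₁ : I} (h01 : i₀ ≠ i₁)
    (hI : ∀ l, l = i₀ ∨ l = i₁) (Φ : ∀ i, CMType (K i)) [Algebra T₀ (K i₀)] [Algebra T₁ (K i₁)]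
    (htr₀ : ∀ (a : K i₀ →+* ℂ) (k : K i₀), a k ∈ normalClosure ℚ (K i₁) ℂ → k ∈ Set.range (algebraMap T₀ (K i₀)))
    (htr₁ : ∀ (b : K i₁ →+* ℂ) (k : K i₁), b k ∈ normalClosure ℚ (K i₀) ℂ → k ∈ Set.range (algebraMap T₁ (K i₁)))
    {C : Type} [Fintype C] {J₀ J₁ : Type} [Fintype J₀] [Fintype J₁] (c₀ : J₀ → C) (c₁ : J₁ → C)
    {A₀ : J₀ → Submodule ℚ ((T₀ →+* ℂ) → ℚ)} {A₁ : J₁ → Submodule ℚ ((T₁ →+* ℂ) → ℚ)}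
    (hA₀st : ∀ (j : J₀) (k : ℂ ≃+* ℂ) (a : (T₀ →+* ℂ) → ℚ), a ∈ A₀ j → (fun y => a (k • y)) ∈ A₀ j)
    (hA₀irr : ∀ (j : J₀) (W : Submodule ℚ ((T₀ →+* ℂ) → ℚ)), W ≤ A₀ j → W ≠ ⊥ →
      (∀ (k : ℂ ≃+* ℂ) (f : (T₀ →+* ℂ) → ℚ), f ∈ W → (fun y => f (k • y)) ∈ W) → W = A₀ j)
    (hA₁st : ∀ (j : J₁) (k : ℂ ≃+* ℂ) (a : (T₁ →+* ℂ) → ℚ), a ∈ A₁ j → (fun y => a (k • y)) ∈ A₁ j)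
    (hA₁irr : ∀ (j : J₁) (W : Submodule ℚ ((T₁ →+* ℂ) → ℚ)), W ≤ A₁ j → W ≠ ⊥ →
      (∀ (k : ℂ ≃+* ℂ) (f : (T₁ →+* ℂ) → ℚ), f ∈ W → (fun y => f (k • y)) ∈ W) → W = A₁ j)
    (h₀₀ : ∀ (j k : J₀) (L : ((T₀ →+* ℂ) → ℚ) →ₗ[ℚ] ((T₀ →+* ℂ) → ℚ)), c₀ j ≠ c₀ k → A₀ j ≠ ⊥ →
      (∀ a ∈ A₀ j, L a ∈ A₀ k) → (∀ a ∈ A₀ j, L a = 0 → a = 0) →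
      (∀ (g : ℂ ≃+* ℂ) (a : (T₀ →+* ℂ) → ℚ), a ∈ A₀ j → L (fun y => a (g • y)) = fun y => L a (g • y)) → False)
    (h₀₁ : ∀ (j : J₀) (k : J₁) (L : ((T₀ →+* ℂ) → ℚ) →ₗ[ℚ] ((T₁ →+* ℂ) → ℚ)), c₀ j ≠ c₁ k → A₀ j ≠ ⊥ →
      (∀ a ∈ A₀ j, L a ∈ A₁ k) → (∀ a ∈ A₀ j, L a = 0 → a = 0) →
      (∀ (g : ℂ ≃+* ℂ) (a : (T₀ →+* ℂ) → ℚ), a ∈ A₀ j → L (fun y => a (g • y)) = fun y => L a (g • y)) → False)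
    (h₁₀ : ∀ (j : J₁) (k : J₀) (L : ((T₁ →+* ℂ) → ℚ) →ₗ[ℚ] ((T₀ →+* ℂ) → ℚ)), c₁ j ≠ c₀ k → A₁ j ≠ ⊥ →
      (∀ a ∈ A₁ j, L a ∈ A₀ k) → (∀ a ∈ A₁ j, L a = 0 → a = 0) →
      (∀ (g : ℂ ≃+* ℂ) (a : (T₁ →+* ℂ) → ℚ), a ∈ A₁ j → L (fun y => a (g • y)) = fun y => L a (g • y)) → False)
    (h₁₁ : ∀ (j k : J₁) (L : ((T₁ →+* ℂ) → ℚ) →ₗ[ℚ] ((T₁ →+* ℂ) → ℚ)), c₁ j ≠ c₁ k → A₁ j ≠ ⊥ →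
      (∀ a ∈ A₁ j, L a ∈ A₁ k) → (∀ a ∈ A₁ j, L a = 0 → a = 0) →
      (∀ (g : ℂ ≃+* ℂ) (a : (T₁ →+* ℂ) → ℚ), a ∈ A₁ j → L (fun y => a (g • y)) = fun y => L a (g • y)) → False)
    (hsum₀ : antiWeights (E := T₀ →+* ℂ) (starRingAut : ℂ ≃+* ℂ) ≤ ⨆ j, A₀ j)
    (hsum₁ : antiWeights (E := T₁ →+* ℂ) (starRingAut : ℂ ≃+* ℂ) ≤ ⨆ j, A₁ j) :
    ∃ (p₀ : C → ((T₀ →+* ℂ) → ℚ)) (p₁ : C → ((T₁ →+* ℂ) → ℚ)),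
      (∀ c, p₀ c ∈ ⨆ j : {j // c₀ j = c}, A₀ j.1) ∧ (∀ c, p₁ c ∈ ⨆ j : {j // c₁ j = c}, A₁ j.1) ∧
      (fun y : T₀ →+* ℂ => ∑ t ∈ Finset.univ.filter (fun t : K i₀ →+* ℂ => t.comp (algebraMap T₀ (K i₀)) = y),
        antiVec (Φ i₀).1 (1 : ℂ ≃+* ℂ) t) = ∑ c, p₀ c ∧
      (fun y : T₁ →+* ℂ => ∑ t ∈ Finset.univ.filter (fun t : K i₁ →+* ℂ => t.comp (algebraMap T₁ (K i₁)) = y),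
        antiVec (Φ i₁).1 (1 : ℂ ≃+* ℂ) t) = ∑ c, p₁ c ∧
      cmTypeRank (Φ i₀) + cmTypeRank (Φ i₁) = CMAlgebra.cmFamilyRank Φ + 1 +
        ∑ c, Module.finrank ℚ ↥(Submodule.span ℚ (Set.range fun y : T₀ →+* ℂ => fun g : ℂ ≃+* ℂ => p₀ c (g • y)) ⊓
          Submodule.span ℚ (Set.range fun y : T₁ →+* ℂ => fun g : ℂ ≃+* ℂ => p₁ c (g • y))) :=
  exists_cmTypeRank_add_cmTypeRank_eq_add_sum_of_classes h01 hI Φ htr₀ htr₁ c₀ c₁ hA₀st hA₀irr hA₁st hA₁irr h₀₀ h₀₁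
    h₁₀ h₁₁ (hsum₀ (shadow_comp_algebraMap_mem_antiWeights (Φ i₀)))
    (hsum₁ (shadow_comp_algebraMap_mem_antiWeights (Φ i₁)))

end Summit.HodgeConjecture.CorCM

end
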